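import Mathlib

/-!
# PercRepro — THE TRUNCATED FINE TAIL: a geometric tail lemma and the ratio of the fine terms (night-1, gen 20; dossier §31.13)

Infrastructure for evaluating the fine tail bound `B_fine` (RankLevelSetRuleQSliceBottomCrude) on cells with large `m` without
unrolling all `m + 1` terms of the `a`-sum:
* `trunc_geom_tail` — if `t(a+1) ≤ ρ·t(a)` for `a ≥ a₀` (`0 ≤ ρ < 1`, `t ≥ 0`) then `Σ_{a≤m} t(a) ≤ Σ_{a≤a₀} t(a) + t(a₀)·ρ/(1−ρ)`;
* `fine_term_ratio` — the fine terms `t(a) = C(m, a)·(r+1)_a/(n+1)^a` satisfy `t(a+1) ≤ ρ·t(a)` for `a ≥ a₀` with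
  `ρ = ((m−a₀)/(a₀+1))·((r+m)/(n+1))` (for `a₀ ≤ m`; beyond `m` the terms vanish).
So every gap cell `q ≥ k(k−3)/2` and every large-`m` bottom cell becomes a short `norm_num` instance once `a₀` is chosen with `ρ < 1`
(`a₀ ≈ m·(r+m)/(n+1+r+m)`). Mathlib-only. Axioms: standard.
-/

namespace PercRepro

open Finset

/-- **A geometric tail**: if `t(a+1) ≤ ρ·t(a)` for `a ≥ a₀` (`0 ≤ ρ < 1`, `t ≥ 0`), then
`Σ_{a ≤ m} t(a) ≤ Σ_{a ≤ a₀} t(a) + t(a₀)·ρ/(1 − ρ)` for every `m` (the truncated evaluation of the fine tail bound). -/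
lemma trunc_geom_tail (t : ℕ → ℚ) (ρ : ℚ) (h0 : 0 ≤ ρ) (h1 : ρ < 1) (a₀ : ℕ)
    (ht : ∀ a, a₀ ≤ a → t (a + 1) ≤ ρ * t a) (hnn : ∀ a, 0 ≤ t a) (m : ℕ) :
    ∑ a ∈ range (m + 1), t a ≤ ∑ a ∈ range (a₀ + 1), t a + t a₀ * ρ / (1 - ρ) := by
  -- t(a₀ + i) ≤ ρ^i t(a₀)
  have hpow : ∀ i, t (a₀ + i) ≤ ρ ^ i * t a₀ := by
    intro i
    induction i with
    | zero => simp
    | succ i ih =>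
      calc t (a₀ + (i + 1)) = t (a₀ + i + 1) := by rw [Nat.add_assoc]
        _ ≤ ρ * t (a₀ + i) := ht _ (by omega)
        _ ≤ ρ * (ρ ^ i * t a₀) := mul_le_mul_of_nonneg_left ih h0
        _ = ρ ^ (i + 1) * t a₀ := by ring
  have hρ1 : 0 < 1 - ρ := by linarith
  rcases Nat.lt_or_ge m (a₀ + 1) with hm | hm
  · -- m ≤ a₀: the partial sum is at most the full one up to a₀
    have : ∑ a ∈ range (m + 1), t a ≤ ∑ a ∈ range (a₀ + 1), t a :=
      Finset.sum_le_sum_of_subset_of_nonneg (Finset.range_mono (by omega)) (fun a _ _ => hnn a)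
    have : 0 ≤ t a₀ * ρ / (1 - ρ) := div_nonneg (mul_nonneg (hnn a₀) h0) hρ1.le
    linarith
  · -- split at a₀ + 1
    obtain ⟨s, hs⟩ : ∃ s, m + 1 = (a₀ + 1) + s := ⟨m - a₀, by omega⟩
    rw [hs, Finset.sum_range_add]
    have hgeom : ∑ i ∈ range s, t (a₀ + 1 + i) ≤ t a₀ * ρ / (1 - ρ) := by
      calc ∑ i ∈ range s, t (a₀ + 1 + i) ≤ ∑ i ∈ range s, ρ ^ (i + 1) * t a₀ := by
            apply Finset.sum_le_sum
            intro i _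
            have := hpow (i + 1)
            rw [show a₀ + 1 + i = a₀ + (i + 1) by ring]
            exact this
        _ = t a₀ * ρ * ∑ i ∈ range s, ρ ^ i := by
            rw [Finset.mul_sum]; refine Finset.sum_congr rfl (fun i _ => by ring)
        _ ≤ t a₀ * ρ * (1 / (1 - ρ)) := by
            apply mul_le_mul_of_nonneg_left _ (mul_nonneg (hnn a₀) h0)
            rw [geom_sum_eq (by linarith : ρ ≠ 1)]
            have e : (ρ ^ s - 1) / (ρ - 1) = (1 - ρ ^ s) / (1 - ρ) := by
              rw [← neg_sub 1 (ρ ^ s), ← neg_sub 1 ρ, neg_div_neg_eq]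
            rw [e, div_le_div_iff₀ hρ1 hρ1]
            have : 0 ≤ ρ ^ s := by positivity
            nlinarith
        _ = t a₀ * ρ / (1 - ρ) := by ring
    linarith [hgeom]


/-- The terms `t(a) = C(m, a)·(r+1)_a/(n+1)^a` of the fine bound decrease geometrically beyond `a₀`:
`t(a+1) ≤ ρ·t(a)` for `a ≥ a₀`, with `ρ = ((m − a₀)/(a₀ + 1))·((r + m)/(n + 1))` (for `a < m`; for `a ≥ m` the term vanishes). -/
lemma fine_term_ratio (n r m a₀ : ℕ) (hn : 0 < n) : ∀ a, a₀ ≤ a →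
    (m.choose (a + 1) : ℚ) * ((∏ b ∈ range (a + 1), ((r : ℚ) + 1 + b)) / ((n : ℚ) + 1) ^ (a + 1))
      ≤ ((((m : ℚ) - a₀) / ((a₀ : ℚ) + 1)) * (((r : ℚ) + m) / ((n : ℚ) + 1)))
        * ((m.choose a : ℚ) * ((∏ b ∈ range a, ((r : ℚ) + 1 + b)) / ((n : ℚ) + 1) ^ a)) := by
  intro a ha
  rcases Nat.lt_or_ge a m with ham | ham
  · -- C(m, a+1)(a+1) = C(m, a)(m − a)
    have h := Nat.choose_succ_right_eq m a
    have hc := congrArg (fun x : ℕ => (x : ℚ)) h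
    push_cast [Nat.cast_sub ham.le] at hc
    have ha0 : (a₀ : ℚ) ≤ a := by exact_mod_cast ha
    have ham' : (a : ℚ) + 1 ≤ m := by exact_mod_cast ham
    have hn' : (0 : ℚ) < (n : ℚ) + 1 := by positivity
    have hP : (0 : ℚ) ≤ ∏ b ∈ range a, ((r : ℚ) + 1 + b) := Finset.prod_nonneg (fun b _ => by positivity)
    have hC : (0 : ℚ) ≤ (m.choose a : ℚ) := by positivity
    -- C(m, a+1) = C(m, a)(m−a)/(a+1) ≤ C(m, a)(m−a₀)/(a₀+1)
    have hCa : (m.choose (a + 1) : ℚ) = (m.choose a : ℚ) * (((m : ℚ) - a) / ((a : ℚ) + 1)) := by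
      rw [mul_div_assoc', eq_div_iff (by positivity)]
      linarith [hc]
    have hfrac : ((m : ℚ) - a) / ((a : ℚ) + 1) ≤ ((m : ℚ) - a₀) / ((a₀ : ℚ) + 1) := by
      rw [div_le_div_iff₀ (by positivity) (by positivity)]; nlinarith
    have hlast : ((r : ℚ) + 1 + a) / ((n : ℚ) + 1) ≤ ((r : ℚ) + m) / ((n : ℚ) + 1) := by
      apply div_le_div_of_nonneg_right _ hn'.le; linarith
    rw [Finset.prod_range_succ, pow_succ, hCa]
    have e : (m.choose a : ℚ) * (((m : ℚ) - a) / ((a : ℚ) + 1)) * ((∏ b ∈ range a, ((r : ℚ) + 1 + b)) * ((r : ℚ) + 1 + a) / (((n : ℚ) + 1) ^ a * ((n : ℚ) + 1)))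
        = (((m : ℚ) - a) / ((a : ℚ) + 1)) * (((r : ℚ) + 1 + a) / ((n : ℚ) + 1))
          * ((m.choose a : ℚ) * ((∏ b ∈ range a, ((r : ℚ) + 1 + b)) / ((n : ℚ) + 1) ^ a)) := by
      field_simp
    rw [e]
    apply mul_le_mul_of_nonneg_right _ (by positivity)
    apply mul_le_mul hfrac hlast (by positivity) (by
      apply div_nonneg _ (by positivity); linarith)
  · -- a ≥ m: C(m, a+1) = 0, and the right side is ≥ 0 when a₀ ≤ m, else the claim still holds since the term is 0 ≤ 0·… — we
    -- only need it for a₀ ≤ m; for a₀ > m both sides vanish (C(m, a) = 0 as well since a ≥ a₀ > m)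
    rw [Nat.choose_eq_zero_of_lt (by omega)]
    simp only [Nat.cast_zero, zero_mul]
    rcases Nat.lt_or_ge m a₀ with hlt | hge
    · rw [Nat.choose_eq_zero_of_lt (by omega)]; simp
    · apply mul_nonneg
      · apply mul_nonneg
        · apply div_nonneg _ (by positivity)
          have : (a₀ : ℚ) ≤ m := by exact_mod_cast hge
          linarith
        · positivity
      · positivity

end PercRepro
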